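import Literature.Geometry.Lorentzian.KerrLowFrequencyPotentialSmallA
import Literature.Geometry.Lorentzian.KerrTrappingMultipliers
import HarnessLib

/-!
# The separated potential at low frequency for general `a`: far-region decay and the bound
# `|Ṽ| ≤ K·Δ/(r² + a²)` (inputs of DRSR Prop. 8.7.3)

(family `gr`, infrastructure for statement **gr.S24**; namespace `Literature.Geometry.Lorentzian.Kerr`)

The near-stationary subrange of Dafermos–Rodnianski–Shlapentokh-Rothman (*Decay for solutions of
the wave equation on Kerr exterior spacetimes III*, arXiv:1402.7034 = Ann. of Math. 183 (2016)),
§8.7.3 (Prop. 8.7.3: `|ω| ≤ ω_low`, `m ≠ 0`, `a ≥ ã₀`), uses of Carter's potential: "`V = Λ/r² +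
O(r⁻³)` as `r → ∞` and, since `m ≠ 0`, `Λ ≥ 2`. This implies that for any `1 ≪ α ≪ β < ∞` …
`r ∈ [α, β] ⟹ V − ω² ≥ b/r²`"; "`R₁` sufficiently large implies that `V' < 0` for
`r ∈ [R₁, ∞)`"; and, for the weight `ỹ = −exp(−C∫υ)` (`υ = Δ` near `r₊`, `υ = 1` far out), the
boundedness of `ỹ²Ṽ²/((ỹ')²ω₀²) = Ṽ²/(C²υ²ω₀²)`, i.e. of **`Ṽ/υ`** (`Ṽ = V − V|_{r=r₊}`). Here,
for any `0 ≤ a ≤ M` (no smallness of `a`) and any admissible triple with `|ω| ≤ ω_l`,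
`10Mω_l ≤ 1`:

* `Kerr.pert_far_dominated_largeR`, **`Kerr.sepPotential_far_ratio_largeR`** (`(3/2)V ≤ rq(−V')`
  for `r ≥ 60M`), `Kerr.sepPotential_ge_largeR` (**`V ≥ Λ/(2r²)`** and `V ≥ M/(2r³)` for
  `r ≥ 60M`);
* **`Kerr.abs_sepPotentialTilde_le_mul_q`** — `|V(r) − V(r₊)| ≤ K·Δ/(r² + a²)` on `r ≥ r₊`, with
  `K = Kerr.tildeOverQBound M a Λ` explicit (`|a| < M`): near `r₊` from `|dV/dr| ≤ κ₂` and
  `Δ/(r² + a²) ≥ (r − r₊)√(M² − a²)/r²`, far from `r₊` from `|V| ≤ 3Λ/r₊² + 3M/r₊³` and the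
  monotonicity of `Δ/(r² + a²)`.

No named facts (D-0026); everything is proved.

## References

* M. Dafermos, I. Rodnianski, Y. Shlapentokh-Rothman, arXiv:1402.7034 = Ann. of Math. 183 (2016),
  §8.7.3 (proof of Prop. 8.7.3: (alphaBeta), the constants `R₁`, `C(ã₀)`, (propertiesofp),
  (smallOmegaSecond)) (key `DafermosRodnianskiShlapentokhrothman2014`).
-/

noncomputable section

open Set

namespace Literature.Geometry.Lorentzian

namespace Kerr

/-! ### The far region for general `a` -/

/-- **The perturbation is dominated far out, general `a`**: for `r ≥ 60M`, `0 ≤ a ≤ M`,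
`|ω| ≤ ω_l`, `10Mω_l ≤ 1` and an admissible triple,
`(3/2)|P| + r|dP/dr| ≤ (1/10)·ΛΔ/(r² + a²)²`. [folklore] -/
theorem pert_far_dominated_largeR {M a ω ωl Λ r : ℝ} {m : ℤ} (hM : 0 < M) (ha0 : 0 ≤ a)
    (haM : a ≤ M) (hadm : IsAdmissibleTriple a ω m Λ) (hω : |ω| ≤ ωl) (hsmall : 10 * (M * ωl) ≤ 1)
    (hr : 60 * M ≤ r) :
    3 / 2 * |pertPotential M a ω m r| + r * |pertPotentialDeriv M a ω m r| ≤
      1 / 10 * (Λ * (delta M a r / (r ^ 2 + a ^ 2) ^ 2)) := by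
  have hr0 : 0 < r := by linarith
  have haM' : |a| ≤ M := by rw [abs_of_nonneg ha0]; exact haM
  have har : a ≤ r := by linarith
  have hωl : 0 ≤ ωl := (abs_nonneg ω).trans hω
  have hΛ := hadm.nonneg
  have hm2 : (m : ℝ) ^ 2 ≤ Λ := hadm.sq_le
  set μ := |(m : ℝ)| with hμ
  have hμ0 : 0 ≤ μ := abs_nonneg _
  have hμ2 : μ ^ 2 = (m : ℝ) ^ 2 := sq_abs _
  have hμμ : μ ≤ (m : ℝ) ^ 2 := by
    rw [← hμ2]
    rcases eq_or_ne m 0 with h | h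
    · simp [hμ, h]
    · have : (1 : ℝ) ≤ μ := by
        rw [hμ, ← Int.cast_abs]; exact_mod_cast Int.one_le_abs h
      nlinarith
  have hP := abs_pertPotential_le (m := m) hM.le ha0 hr0 hω
  have hP' := abs_pertPotentialDeriv_le (m := m) hM.le ha0 hr0 har hω
  have hD := axi_D_ge_far hM haM' hΛ (show 20 * M ≤ r by linarith)
  rw [← hμ] at hP hP'
  have hL : 3 / 2 * |pertPotential M a ω m r| + r * |pertPotentialDeriv M a ω m r| ≤
      (18 * M * r * (a * ωl) * μ + 11 / 2 * a ^ 2 * (m : ℝ) ^ 2) / r ^ 4 := by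
    have e : (18 * M * r * (a * ωl) * μ + 11 / 2 * a ^ 2 * (m : ℝ) ^ 2) / r ^ 4 =
        3 / 2 * ((4 * M * r * a * μ * ωl + a ^ 2 * (m : ℝ) ^ 2) / r ^ 4) +
        r * ((12 * M * a * μ * ωl * r ^ 2 + 4 * r * a ^ 2 * (m : ℝ) ^ 2) / r ^ 6) := by
      field_simp; ring
    rw [e]
    have h1 := mul_le_mul_of_nonneg_left hP (by norm_num : (0 : ℝ) ≤ 3 / 2)
    have h2 := mul_le_mul_of_nonneg_left hP' hr0.le
    linarith
  refine hL.trans (le_trans ?_ (mul_le_mul_of_nonneg_left hD (by norm_num)))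
  rw [show 1 / 10 * (7 / 8 * Λ / r ^ 2) = 7 / 80 * Λ * r ^ 2 / r ^ 4 by field_simp; ring]
  rw [div_le_div_iff_of_pos_right (by positivity)]
  -- 18 M r (a ωl) μ ≤ 18 r (M ωl) M m² ≤ 1.8 M r m² ≤ 0.03 m² r² ;  5.5 a² m² ≤ 5.5 M² m² ≤ m² r²/600
  have h1 : 18 * M * r * (a * ωl) * μ ≤ 3 / 100 * (m : ℝ) ^ 2 * r ^ 2 := by
    have s1 : a * ωl ≤ M * ωl := mul_le_mul_of_nonneg_right haM hωl
    have s2 : 18 * M * r * (a * ωl) * μ ≤ 18 * M * r * (M * ωl) * μ := by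
      have h0 : 0 ≤ 18 * M * r * μ := by positivity
      nlinarith [mul_le_mul_of_nonneg_right s1 h0]
    have s3 : 18 * M * r * (M * ωl) * μ ≤ 18 * M * r * (1 / 10) * μ := by
      have : M * ωl ≤ 1 / 10 := by linarith
      have h0 : 0 ≤ 18 * M * r * μ := by positivity
      nlinarith [mul_le_mul_of_nonneg_right this h0]
    have s4 : M * r * μ ≤ r ^ 2 / 60 * (m : ℝ) ^ 2 := by
      have : M * r ≤ r ^ 2 / 60 := by nlinarith
      exact mul_le_mul this hμμ hμ0 (by positivity)
    nlinarith
  have h2 : 11 / 2 * a ^ 2 * (m : ℝ) ^ 2 ≤ 11 / 2 / 3600 * (m : ℝ) ^ 2 * r ^ 2 := by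
    have : a ^ 2 ≤ r ^ 2 / 3600 := by nlinarith
    nlinarith [mul_le_mul_of_nonneg_left this (by positivity : (0 : ℝ) ≤ (m : ℝ) ^ 2)]
  nlinarith [mul_le_mul_of_nonneg_right hm2 (by positivity : (0 : ℝ) ≤ r ^ 2)]

/-- **The far-region decay property for general `a`** (DRSR arXiv:1402.7034, §8.7.3: "`R₁`
sufficiently large implies that `V' < 0` for `r ∈ [R₁, ∞)`", quantitatively): for `r ≥ 60M`,
`0 ≤ a ≤ M`, `|ω| ≤ ω_l`, `10Mω_l ≤ 1`, admissible `(ω, m, Λ)`: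
`(3/2)V(r) ≤ r·(Δ/(r² + a²))·(−dV/dr)(r)`. [cite: DafermosRodnianskiShlapentokhrothman2014, Prop. 8.7.3 (proof)] -/
theorem sepPotential_far_ratio_largeR {M a ω ωl Λ r : ℝ} {m : ℤ} (hM : 0 < M) (ha0 : 0 ≤ a)
    (haM : a ≤ M) (hadm : IsAdmissibleTriple a ω m Λ) (hω : |ω| ≤ ωl)
    (hsmall : 10 * (M * ωl) ≤ 1) (hr : 60 * M ≤ r) :
    3 / 2 * sepPotential M a ω m Λ r ≤
      r * (delta M a r / (r ^ 2 + a ^ 2)) * (-deriv (sepPotential M a ω m Λ) r) := by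
  have hr0 : 0 < r := by linarith
  have haM' : |a| ≤ M := by rw [abs_of_nonneg ha0]; exact haM
  have hΛ := hadm.nonneg
  have hD0 : 0 < r ^ 2 + a ^ 2 := by positivity
  have hrp : rPlus M a ≤ r := by linarith [rPlus_le_two_mul_smallA hM.le a]
  have hq : 0 ≤ delta M a r / (r ^ 2 + a ^ 2) := div_nonneg (delta_nonneg haM' hrp) hD0.le
  have hq1 : delta M a r / (r ^ 2 + a ^ 2) ≤ 1 := by
    rw [div_le_one hD0]; unfold delta; nlinarith
  have hratio := sepPotential_axi_far_ratio' (ω := ω) hM haM' hΛ (show 20 * M ≤ r by linarith)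
  have hpert := pert_far_dominated_largeR hM ha0 haM hadm hω hsmall hr
  have hVaxi : Λ * (delta M a r / (r ^ 2 + a ^ 2) ^ 2) ≤ sepPotential M a ω 0 Λ r := by
    rw [sepPotential_axi_eq]
    linarith [sepPotential₁_nonneg haM' hrp]
  rw [sepPotential_eq_axi_add_pert, deriv_sepPotential_eq_axi_add_pert M a ω m Λ hD0.ne']
  have hP := le_abs_self (pertPotential M a ω m r)
  have h1 : -(r * |pertPotentialDeriv M a ω m r|) ≤
      r * (delta M a r / (r ^ 2 + a ^ 2)) * (-pertPotentialDeriv M a ω m r) := by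
    have h2 : |delta M a r / (r ^ 2 + a ^ 2) * pertPotentialDeriv M a ω m r| ≤
        |pertPotentialDeriv M a ω m r| := by
      rw [abs_mul, abs_of_nonneg hq]
      exact mul_le_of_le_one_left (abs_nonneg _) hq1
    have h3 : delta M a r / (r ^ 2 + a ^ 2) * pertPotentialDeriv M a ω m r ≤
        |pertPotentialDeriv M a ω m r| := (le_abs_self _).trans h2
    have h4 := mul_le_mul_of_nonneg_left h3 hr0.le
    have e : r * (delta M a r / (r ^ 2 + a ^ 2)) * (-pertPotentialDeriv M a ω m r) =
        -(r * (delta M a r / (r ^ 2 + a ^ 2) * pertPotentialDeriv M a ω m r)) := by ring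
    rw [e]
    linarith
  have h2 : 3 / 2 * pertPotential M a ω m r ≤ 3 / 2 * |pertPotential M a ω m r| := by linarith
  nlinarith

/-- **`V ≥ Λ/(2r²)` and `V ≥ M/(2r³)` for `r ≥ 60M`, general `a`** (`|P| ≤ (1/10)ΛΔ/(r² + a²)²`
there; "`V = Λ/r² + O(r⁻³)`", (alphaBeta) of DRSR arXiv:1402.7034, §8.7.3, quantitatively).
[cite: DafermosRodnianskiShlapentokhrothman2014, Prop. 8.7.3 (proof)] -/
theorem sepPotential_ge_largeR {M a ω ωl Λ r : ℝ} {m : ℤ} (hM : 0 < M) (ha0 : 0 ≤ a)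
    (haM : a ≤ M) (hadm : IsAdmissibleTriple a ω m Λ) (hω : |ω| ≤ ωl)
    (hsmall : 10 * (M * ωl) ≤ 1) (hr : 60 * M ≤ r) :
    Λ / (2 * r ^ 2) ≤ sepPotential M a ω m Λ r ∧ M / (2 * r ^ 3) ≤ sepPotential M a ω m Λ r := by
  have hr0 : 0 < r := by linarith
  have haM' : |a| ≤ M := by rw [abs_of_nonneg ha0]; exact haM
  have hΛ := hadm.nonneg
  have hrp : rPlus M a ≤ r := by linarith [rPlus_le_two_mul_smallA hM.le a]
  have h := pert_far_dominated_largeR hM ha0 haM hadm hω hsmall hr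
  have hD := axi_D_ge_far hM haM' hΛ (show 20 * M ≤ r by linarith)
  have hP' : |pertPotential M a ω m r| ≤ 1 / 10 * (Λ * (delta M a r / (r ^ 2 + a ^ 2) ^ 2)) := by
    nlinarith [abs_nonneg (pertPotentialDeriv M a ω m r), abs_nonneg (pertPotential M a ω m r)]
  have hP'' := neg_abs_le (pertPotential M a ω m r)
  have hV₁ := sepPotential₁_ge_of_four_mul_le hM haM' (show 4 * M ≤ r by linarith)
  have hV₁0 := sepPotential₁_nonneg haM' hrp
  have h78 : 0 ≤ 7 / 8 * Λ / r ^ 2 := by positivity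
  rw [sepPotential_eq_axi_add_pert, sepPotential_axi_eq]
  constructor
  · -- Λ/(2r²) ≤ (9/10) Λ D ≤ Λ D − |P| + V₁
    have : Λ / (2 * r ^ 2) ≤ 9 / 10 * (7 / 8 * Λ / r ^ 2) := by
      rw [div_le_iff₀ (by positivity)]
      have e : 9 / 10 * (7 / 8 * Λ / r ^ 2) * (2 * r ^ 2) = 63 / 40 * Λ := by field_simp; ring
      rw [e]; nlinarith
    nlinarith
  · nlinarith

/-! ### The bound `|Ṽ| ≤ K·Δ/(r² + a²)` -/

/-- The explicit constant `K` with `|V(r) − V(r₊)| ≤ K·Δ/(r² + a²)` on `r ≥ r₊`: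
`K = 4κ₂r₊²/√(M² − a²) + 2(3Λ/r₊² + 3M/r₊³)(4r₊² + a²)/Δ(2r₊)`, `κ₂ = 24Λ/r₊³ + 184M/r₊⁴`.
[folklore] -/
def tildeOverQBound (M a Λ : ℝ) : ℝ :=
  4 * (24 * Λ / rPlus M a ^ 3 + 184 * M / rPlus M a ^ 4) * rPlus M a ^ 2 / √(M ^ 2 - a ^ 2) +
    2 * (3 * Λ / rPlus M a ^ 2 + 3 * M / rPlus M a ^ 3) *
      (((2 * rPlus M a) ^ 2 + a ^ 2) / delta M a (2 * rPlus M a))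

/-- `K ≥ 0` (`|a| < M`, admissible `Λ ≥ 0`). [folklore] -/
theorem tildeOverQBound_nonneg {M a Λ : ℝ} (hMa : IsSubextremal M a) (hΛ : 0 ≤ Λ) :
    0 ≤ tildeOverQBound M a Λ := by
  have hM := hMa.pos
  have haM : |a| ≤ M := le_of_lt hMa
  have hrp0 : 0 < rPlus M a := hM.trans_le (M_le_rPlus M a)
  have hΔ : 0 < delta M a (2 * rPlus M a) := delta_pos haM (by linarith)
  have hs := Real.sqrt_nonneg (M ^ 2 - a ^ 2)
  unfold tildeOverQBound
  positivity

/-- **`|Ṽ| ≤ K·Δ/(r² + a²)` on `r ≥ r₊`** (`Ṽ = V − V(r₊)`; `|a| < M`, admissible triple): the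
boundedness of `Ṽ/υ` behind "taking `ε` sufficiently small and then `C = C(ã₀)` sufficiently large"
in (smallOmegaSecond) of DRSR arXiv:1402.7034, §8.7.3 — near `r₊` (`r ≤ 2r₊`) from
`|dV/dr| ≤ κ₂` (mean value theorem) and `Δ/(r² + a²) ≥ (r − r₊)√(M² − a²)/r²`; for `r ≥ 2r₊` from
`|V| ≤ 3Λ/r₊² + 3M/r₊³` and `Δ/(r² + a²) ≥ Δ(2r₊)/(4r₊² + a²)`.
[cite: DafermosRodnianskiShlapentokhrothman2014, Prop. 8.7.3 (proof)] -/
theorem abs_sepPotentialTilde_le_mul_q {M a ω Λ r : ℝ} {m : ℤ} (hMa : IsSubextremal M a)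
    (hadm : IsAdmissibleTriple a ω m Λ) (hr : rPlus M a ≤ r) :
    |sepPotential M a ω m Λ r - sepPotential M a ω m Λ (rPlus M a)| ≤
      tildeOverQBound M a Λ * (delta M a r / (r ^ 2 + a ^ 2)) := by
  have hM := hMa.pos
  have haM : |a| ≤ M := le_of_lt hMa
  have hΛ := hadm.nonneg
  have hrpM : M ≤ rPlus M a := M_le_rPlus M a
  have hrp0 : 0 < rPlus M a := hM.trans_le hrpM
  have hr0 : 0 < r := hrp0.trans_le hr
  have hD0 : 0 < r ^ 2 + a ^ 2 := by positivity
  have hsq : 0 < M ^ 2 - a ^ 2 := by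
    have := hMa; unfold IsSubextremal at this
    nlinarith [abs_nonneg a, sq_abs a]
  have hroot : 0 < √(M ^ 2 - a ^ 2) := Real.sqrt_pos.2 hsq
  have hΔ2 : 0 < delta M a (2 * rPlus M a) := delta_pos haM (by linarith)
  set κ₂ := 24 * Λ / rPlus M a ^ 3 + 184 * M / rPlus M a ^ 4 with hκ₂
  have hκ₂0 : 0 ≤ κ₂ := by rw [hκ₂]; positivity
  set BV := 3 * Λ / rPlus M a ^ 2 + 3 * M / rPlus M a ^ 3 with hBV
  have hBV0 : 0 ≤ BV := by rw [hBV]; positivity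
  have hK1 : 0 ≤ 4 * κ₂ * rPlus M a ^ 2 / √(M ^ 2 - a ^ 2) := by positivity
  have hK2 : 0 ≤ 2 * BV * (((2 * rPlus M a) ^ 2 + a ^ 2) / delta M a (2 * rPlus M a)) := by positivity
  have hKdef : tildeOverQBound M a Λ = 4 * κ₂ * rPlus M a ^ 2 / √(M ^ 2 - a ^ 2) +
      2 * BV * (((2 * rPlus M a) ^ 2 + a ^ 2) / delta M a (2 * rPlus M a)) := by
    rw [hκ₂, hBV]; rfl
  have hq0 : 0 ≤ delta M a r / (r ^ 2 + a ^ 2) := div_nonneg (delta_nonneg haM hr) hD0.le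
  rcases le_or_gt r (2 * rPlus M a) with h2 | h2
  · -- near: MVT for V on [r₊, r] with |V'| ≤ κ₂, and q ≥ (r − r₊)√/r² ≥ (r−r₊)√/(4r₊²)
    have hd : ∀ t, rPlus M a ≤ t → HasDerivAt (sepPotential M a ω m Λ)
        (deriv (sepPotential M a ω m Λ) t) t := fun t ht ↦
      (hasDerivAt_sepPotential M a ω m Λ (by have := hrp0.trans_le ht; positivity)).differentiableAt.hasDerivAt
    have hbound : ∀ t ∈ Icc (rPlus M a) r, ‖deriv (sepPotential M a ω m Λ) t‖ ≤ κ₂ := by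
      intro t ht
      rw [Real.norm_eq_abs]
      have h := abs_deriv_sepPotential_le hM haM hadm ht.1
      have ht0 : 0 < t := hrp0.trans_le ht.1
      have h1 : 24 * Λ / t ^ 3 ≤ 24 * Λ / rPlus M a ^ 3 := by
        apply div_le_div_of_nonneg_left (by positivity) (by positivity); gcongr; exact ht.1
      have h2' : 184 * M / t ^ 4 ≤ 184 * M / rPlus M a ^ 4 := by
        apply div_le_div_of_nonneg_left (by positivity) (by positivity); gcongr; exact ht.1
      rw [hκ₂]; linarith
    have hmvt : |sepPotential M a ω m Λ r - sepPotential M a ω m Λ (rPlus M a)| ≤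
        κ₂ * (r - rPlus M a) := by
      have h := Convex.norm_image_sub_le_of_norm_deriv_le (s := Icc (rPlus M a) r)
        (fun t ht ↦ (hd t ht.1).differentiableAt) (fun t ht ↦ by
          rw [(hd t ht.1).deriv]; exact hbound t ht) (convex_Icc _ _)
        (left_mem_Icc.2 hr) (right_mem_Icc.2 hr)
      rw [Real.norm_eq_abs, Real.norm_eq_abs, abs_of_nonneg (sub_nonneg.2 hr)] at h
      exact h
    have hq : (r - rPlus M a) * √(M ^ 2 - a ^ 2) / (4 * rPlus M a ^ 2) ≤
        delta M a r / (r ^ 2 + a ^ 2) := by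
      refine le_trans ?_ (delta_div_ge hMa hr)
      have hs0' : 0 ≤ (r - rPlus M a) * √(M ^ 2 - a ^ 2) := by
        exact mul_nonneg (sub_nonneg.2 hr) hroot.le
      have hr4 : r ^ 2 ≤ 4 * rPlus M a ^ 2 := by nlinarith
      rw [div_le_div_iff₀ (by positivity) (by positivity)]
      exact mul_le_mul_of_nonneg_left hr4 hs0'
    -- κ₂ (r − r₊) = (4κ₂r₊²/√) · ((r−r₊)√/(4r₊²)) ≤ (4κ₂r₊²/√) q ≤ K q
    have e : κ₂ * (r - rPlus M a) =
        4 * κ₂ * rPlus M a ^ 2 / √(M ^ 2 - a ^ 2) *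
          ((r - rPlus M a) * √(M ^ 2 - a ^ 2) / (4 * rPlus M a ^ 2)) := by
      field_simp
    calc |sepPotential M a ω m Λ r - sepPotential M a ω m Λ (rPlus M a)|
        ≤ κ₂ * (r - rPlus M a) := hmvt
      _ = _ := e
      _ ≤ 4 * κ₂ * rPlus M a ^ 2 / √(M ^ 2 - a ^ 2) * (delta M a r / (r ^ 2 + a ^ 2)) :=
          mul_le_mul_of_nonneg_left hq hK1
      _ ≤ tildeOverQBound M a Λ * (delta M a r / (r ^ 2 + a ^ 2)) := by
          rw [hKdef]
          exact mul_le_mul_of_nonneg_right (by linarith) hq0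
  · -- far: |Ṽ| ≤ 2 BV and q ≥ q(2r₊) = Δ(2r₊)/(4r₊²+a²)
    have hV1 := abs_sepPotential_le (ω := ω) (m := m) hM haM hadm hr
    have hV2 := abs_sepPotential_le (ω := ω) (m := m) hM haM hadm le_rfl
    have hrb : 3 * Λ / r ^ 2 + 3 * M / r ^ 3 ≤ BV := by
      rw [hBV]
      have h1 : 3 * Λ / r ^ 2 ≤ 3 * Λ / rPlus M a ^ 2 := by
        apply div_le_div_of_nonneg_left (by positivity) (by positivity); gcongr
      have h2' : 3 * M / r ^ 3 ≤ 3 * M / rPlus M a ^ 3 := by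
        apply div_le_div_of_nonneg_left (by positivity) (by positivity); gcongr
      linarith
    have habs : |sepPotential M a ω m Λ r - sepPotential M a ω m Λ (rPlus M a)| ≤ 2 * BV := by
      refine (abs_sub _ _).trans ?_
      rw [hBV] at hrb ⊢
      linarith
    have hqmono : delta M a (2 * rPlus M a) / ((2 * rPlus M a) ^ 2 + a ^ 2) ≤
        delta M a r / (r ^ 2 + a ^ 2) :=
      delta_div_mono hM.le (by positivity) (by
        have : |a| ≤ 2 * rPlus M a := haM.trans (by linarith)
        exact this) h2.le
    have hq2 : 0 < delta M a (2 * rPlus M a) / ((2 * rPlus M a) ^ 2 + a ^ 2) :=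
      div_pos hΔ2 (by positivity)
    -- 2BV = 2BV·(D/Δ₂)·(Δ₂/D) ≤ 2BV (D/Δ₂) q
    have e : 2 * BV = 2 * BV * (((2 * rPlus M a) ^ 2 + a ^ 2) / delta M a (2 * rPlus M a)) *
        (delta M a (2 * rPlus M a) / ((2 * rPlus M a) ^ 2 + a ^ 2)) := by
      field_simp
    calc |sepPotential M a ω m Λ r - sepPotential M a ω m Λ (rPlus M a)| ≤ 2 * BV := habs
      _ = _ := e
      _ ≤ 2 * BV * (((2 * rPlus M a) ^ 2 + a ^ 2) / delta M a (2 * rPlus M a)) *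
          (delta M a r / (r ^ 2 + a ^ 2)) := mul_le_mul_of_nonneg_left hqmono hK2
      _ ≤ tildeOverQBound M a Λ * (delta M a r / (r ^ 2 + a ^ 2)) := by
          rw [hKdef]
          exact mul_le_mul_of_nonneg_right (by linarith) hq0

/-- `K` is monotone in `Λ`: `K(Λ) ≤ K(Λ₁)` for `Λ ≤ Λ₁` (all other data fixed). [folklore] -/
theorem tildeOverQBound_mono {M a Λ Λ₁ : ℝ} (hMa : IsSubextremal M a) (hΛ : Λ ≤ Λ₁) :
    tildeOverQBound M a Λ ≤ tildeOverQBound M a Λ₁ := by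
  have hM := hMa.pos
  have haM : |a| ≤ M := le_of_lt hMa
  have hrp0 : 0 < rPlus M a := hM.trans_le (M_le_rPlus M a)
  have hΔ : 0 < delta M a (2 * rPlus M a) := delta_pos haM (by linarith)
  have hs := Real.sqrt_nonneg (M ^ 2 - a ^ 2)
  unfold tildeOverQBound
  have h0 : 0 ≤ ((2 * rPlus M a) ^ 2 + a ^ 2) / delta M a (2 * rPlus M a) := by positivity
  gcongr

end Kerr

end Literature.Geometry.Lorentzian
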